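import Summits.ABC.IUTFork.Thm311ToCor312
import Summits.ABC.IUTFork.Cor312MultiradTwist
import Summits.ABC.IUTFork.Cor312ColumnTransport
import Summits.ABC.IUTFork.Cor312QTwist
import HarnessLib

/-!
# [IUTchIII] Cor. 3.12 — check (B): the glued-regions reading under the C-transports

Record-only file (D-0012) of the abc-iut cell (D-0067 Cor. 3.12 strategy TEAM C «étale-picture /
multiradiality», seat abc-iut-c312-13, row C-11 of `HOME/plan/C312-TEAMS.md`; director check (B) is
co-owned by the C and B leads — `Cor312CheckBGluedRegions.lean` header); TAKES NO SIDE; proof-only.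
w5-d155's check-(B) file isolates the candidate reading (b1) ∧ (b2): the Θ-pilot region and the
q-pilot region are BOTH outputs of one functorial region algorithm (`Thm311ToCor312.ComputedBy` and
the inline q-clause `∀ j v_ℚ, P.qRegion j v_ℚ = A.ρ (S.D n₂) j v_ℚ`, [IUTchIII] Thm. 3.11 (i) p. 154,
(xi-a) p. 181 l. 33–44). THIS file computes how that reading behaves under the re-choices the frozen
types leave open (rows C-1/C-3/C-7):

* CORIC ALONG THE ÉTALE TRANSPORT (§2): `computedBy_recolumn` — moving glue AND column by the SAME
  `Φ` (row C-3's `recolumn`, the typed étale-picture symmetry) PRESERVES (b1); `qGlued_map_of_recolumn`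
  transports (b2) covariantly (to the algorithm's output on the `Φ`-moved data). This is the Team C
  charter sentence in kernel form: multiradiality = functorial invariance of the algorithm's output
  data under the transport that moves all of its inputs together.
* FREE RE-CHOICES ABSORBED (§1): the (Ind3) m-reindex and the re-choice of the OTHER glue change
  nothing (`computedBy_reindexGlue_iff`, `computedBy_qTwistGlue_iff`, `qGlued_twistGlue`,
  `qGlued_reindexGlue`) — no hypothesis.
* BUT EACH GLUE IS PINNED (§3): re-choosing the Θ-glue ALONE within its declared (Ind1)(Ind2)
  indeterminacy (row C-1's `twistGlue`) breaks (b1) unless the algorithm's output is fixed by the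
  twist (`computedBy_twistGlue_iff_fixed`); what always holds is the COVARIANT form
  (`computedBy_map_of_twistGlue`: the twisted glue is the algorithm's output on the TRANSPORTED data)
  — and symmetrically for (b2) under the q-glue twist (`qGlued_qTwistGlue_iff_fixed`,
  `qGlued_map_of_qTwistGlue`). So the (b1) ∧ (b2) reading pins each glue to the algorithm BEYOND the
  orbit-invariant content of the Corollary (which IS invariant under each twist separately — rows
  C-1/C-7): its extra strength over the Statement (kernel: `Cor312CheckBGluedNonEquivalence`)
  includes exactly this pinning. Whether print supplies the pinning is the referee lane (A)(iii)
  locator question and the Scholze–Stix §2.2 dispute; nothing here asserts or denies (b1)/(b2).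

Consumes (read-only): `Thm311ToCor312.RegionAlgorithm/ComputedBy` (c312-1/w5-d155), rows C-1/C-3/C-7.
No new definitions, no `Prop` facts, FACT-LIST not touched. Nothing here asserts Cor. 3.12.
[claim: Mochizuki2012, status: disputed] for the quoted clauses; proofs are [folklore] bookkeeping.
-/

namespace Summit.ABC.IUTFork

namespace Thm311ToCor312

open Thm311 Cor312 Literature.IUT.LogThetaLattice

variable {T : ThetaIndex} {S : Situation T}

/-! ## 1. Free re-choices: (b1) and (b2) absorb the (Ind3) re-index and the OTHER glue's twist -/

/-- **(b1) absorbs the (Ind3) re-index**: the Θ-glue clause reads only the union over `m ∈ ℤ`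
(row C-9's mechanism at the clause level). NO hypothesis. [folklore] -/
theorem computedBy_reindexGlue_iff (A : RegionAlgorithm S) (P : Cor312.Setting S) (e : ℤ ≃ ℤ) :
    ComputedBy (P.reindexGlue e) A ↔ ComputedBy P A := by
  unfold ComputedBy
  refine forall_congr' fun j => forall_congr' fun vQ => ?_
  show ((P.reindexGlue e).thetaRegion3 j vQ = A.ρ (S.D P.n) j vQ) ↔
    (P.thetaRegion3 j vQ = A.ρ (S.D P.n) j vQ)
  rw [P.reindexGlue_thetaRegion3 e j vQ]

/-- **(b1) ignores the q-glue twist** (the Θ-side never reads the q-glue; definitional). [folklore] -/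
theorem computedBy_qTwistGlue_iff (A : RegionAlgorithm S) (P : Cor312.Setting S)
    (Φ₀ : S.L.PacketAut)
    (hmem : ∀ (j : T.Label) (vQ : T.VQ),
      Φ₀ j vQ '' P.qRegionOf (qPilotObject P.qData) j vQ ∈ (P.frame j vQ).Hul)
    (hfin : ∀ j : T.Label, (Function.support fun vQ =>
      (S.D P.n).logvol j vQ (Φ₀ j vQ '' P.qRegionOf (qPilotObject P.qData) j vQ)).Finite) :
    ComputedBy (P.qTwistGlue Φ₀ hmem hfin) A ↔ ComputedBy P A :=
  Iff.rfl

/-- **(b2) ignores the Θ-glue twist** (the q-side never reads the Θ-glue; row C-1's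
`twistGlue_qRegion`). [folklore] -/
theorem qGlued_twistGlue (A : RegionAlgorithm S) (P : Cor312.Setting S) (Φ₀ : S.L.PacketAut)
    {n₂ : ℤ} (hq : ∀ (j : T.Label) (vQ : T.VQ), P.qRegion j vQ = A.ρ (S.D n₂) j vQ)
    (j : T.Label) (vQ : T.VQ) :
    (P.twistGlue Φ₀).qRegion j vQ = A.ρ (S.D n₂) j vQ := by
  rw [P.twistGlue_qRegion Φ₀ j vQ]
  exact hq j vQ

/-- **(b2) absorbs the (Ind3) re-index** (definitional). [folklore] -/
theorem qGlued_reindexGlue (A : RegionAlgorithm S) (P : Cor312.Setting S) (e : ℤ ≃ ℤ)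
    {n₂ : ℤ} (hq : ∀ (j : T.Label) (vQ : T.VQ), P.qRegion j vQ = A.ρ (S.D n₂) j vQ)
    (j : T.Label) (vQ : T.VQ) :
    (P.reindexGlue e).qRegion j vQ = A.ρ (S.D n₂) j vQ :=
  hq j vQ

/-! ## 2. Coricity along the étale transport: glue and column move TOGETHER -/

/-- **(b1) IS CORIC ALONG THE ÉTALE-PICTURE TRANSPORT** (the charter sentence in kernel form): the
recolumn of row C-3 moves the glue and the column by the SAME `Φ` realising Thm. 3.11 (i)'s symmetry
(`S.D n' = (S.D P.n).map Φ`), and the functoriality of the region algorithm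
(`RegionAlgorithm.equivariant`) makes the transported glue again the algorithm's output ON ITS OWN
COLUMN. Contrast §3: moving the glue ALONE does not preserve the clause. [folklore] -/
theorem computedBy_recolumn (A : RegionAlgorithm S) (P : Cor312.Setting S) (n' : ℤ)
    (Φ : S.L.PacketAut) (hD : S.D n' = (S.D P.n).map Φ) (hΦ : Φ ∈ Cor312.Setting.indGroup S)
    (hb1 : ComputedBy P A) : ComputedBy (P.recolumn n' Φ hD) A := by
  intro j vQ
  show (P.recolumn n' Φ hD).thetaRegion3 j vQ = A.ρ (S.D n') j vQ
  rw [P.recolumn_thetaRegion3 n' Φ hD j vQ, hb1 j vQ, ← A.equivariant (S.D P.n) Φ hΦ j vQ, ← hD]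

/-- **(b2) transports covariantly along the étale transport**: the recolumned q-region is the
algorithm's output on the `Φ`-moved data of its column — it re-lands on a column's own data exactly
when `Φ` carries `S.D n₂` to a column (not guaranteed by `MultiradialCompat`, which relates columns
pairwise by SOME member, not by THIS `Φ`; honest scope). [folklore] -/
theorem qGlued_map_of_recolumn (A : RegionAlgorithm S) (P : Cor312.Setting S) (n' : ℤ)
    (Φ : S.L.PacketAut) (hD : S.D n' = (S.D P.n).map Φ) (hΦ : Φ ∈ Cor312.Setting.indGroup S)
    {n₂ : ℤ} (hq : ∀ (j : T.Label) (vQ : T.VQ), P.qRegion j vQ = A.ρ (S.D n₂) j vQ)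
    (j : T.Label) (vQ : T.VQ) :
    (P.recolumn n' Φ hD).qRegion j vQ = A.ρ ((S.D n₂).map Φ) j vQ := by
  rw [P.recolumn_qRegion n' Φ hD j vQ, hq j vQ, ← A.equivariant (S.D n₂) Φ hΦ j vQ]

/-- The PAIR (b1) ∧ (b2) along the étale transport: (b1) re-lands on the new column; (b2) transports
to the `Φ`-moved data. [folklore] -/
theorem gluedRegions_recolumn (A : RegionAlgorithm S) (P : Cor312.Setting S) (n' : ℤ)
    (Φ : S.L.PacketAut) (hD : S.D n' = (S.D P.n).map Φ) (hΦ : Φ ∈ Cor312.Setting.indGroup S)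
    (hb1 : ComputedBy P A)
    {n₂ : ℤ} (hq : ∀ (j : T.Label) (vQ : T.VQ), P.qRegion j vQ = A.ρ (S.D n₂) j vQ) :
    ComputedBy (P.recolumn n' Φ hD) A ∧
      ∀ (j : T.Label) (vQ : T.VQ),
        (P.recolumn n' Φ hD).qRegion j vQ = A.ρ ((S.D n₂).map Φ) j vQ :=
  ⟨computedBy_recolumn A P n' Φ hD hΦ hb1, qGlued_map_of_recolumn A P n' Φ hD hΦ hq⟩

/-! ## 3. Each glue is PINNED: a bare twist of one glue breaks its clause unless the algorithm's
output is fixed by the twist -/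

/-- **The covariant form under a bare Θ-glue twist**: the twisted Θ-glue is the algorithm's output on
the `Φ₀`-TRANSPORTED data — the pair (glue, algorithm input) moves together; the clause AT THE
COLUMN'S OWN DATA is not preserved (next theorem). [folklore] -/
theorem computedBy_map_of_twistGlue (A : RegionAlgorithm S) (P : Cor312.Setting S)
    (Φ₀ : S.L.PacketAut) (hΦ₀ : Φ₀ ∈ Cor312.Setting.indGroup S) (hb1 : ComputedBy P A)
    (j : T.Label) (vQ : T.VQ) :
    (P.twistGlue Φ₀).thetaRegion3 j vQ = A.ρ ((S.D P.n).map Φ₀) j vQ := by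
  rw [P.twistGlue_thetaRegion3 Φ₀ j vQ, hb1 j vQ, ← A.equivariant (S.D P.n) Φ₀ hΦ₀ j vQ]

/-- **(b1) IS NOT INVARIANT under re-choosing the Θ-glue alone**: given (b1) at `P`, the twisted
setting satisfies the SAME clause iff the algorithm's output is fixed by the twist
(`A.ρ ((S.D P.n).map Φ₀) = A.ρ (S.D P.n)`) — generally false. The reading pins the Θ-glue to the
algorithm beyond the (Ind1)(Ind2) orbit; the Corollary itself is twist-invariant (row C-1's
`twistGlue_statement_iff`), so this pinning is part of the reading's extra strength over the
Statement (`Cor312CheckBGluedNonEquivalence`). [folklore] -/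
theorem computedBy_twistGlue_iff_fixed (A : RegionAlgorithm S) (P : Cor312.Setting S)
    (Φ₀ : S.L.PacketAut) (hΦ₀ : Φ₀ ∈ Cor312.Setting.indGroup S) (hb1 : ComputedBy P A) :
    ComputedBy (P.twistGlue Φ₀) A ↔
      ∀ (j : T.Label) (vQ : T.VQ), A.ρ ((S.D P.n).map Φ₀) j vQ = A.ρ (S.D P.n) j vQ := by
  unfold ComputedBy
  refine forall_congr' fun j => forall_congr' fun vQ => ?_
  show ((P.twistGlue Φ₀).thetaRegion3 j vQ = A.ρ (S.D P.n) j vQ) ↔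
    (A.ρ ((S.D P.n).map Φ₀) j vQ = A.ρ (S.D P.n) j vQ)
  rw [P.twistGlue_thetaRegion3 Φ₀ j vQ, hb1 j vQ, ← A.equivariant (S.D P.n) Φ₀ hΦ₀ j vQ]

/-- The covariant form under a bare q-glue twist (mirror of `computedBy_map_of_twistGlue`). [folklore] -/
theorem qGlued_map_of_qTwistGlue (A : RegionAlgorithm S) (P : Cor312.Setting S)
    (Φ₀ : S.L.PacketAut)
    (hmem : ∀ (j : T.Label) (vQ : T.VQ),
      Φ₀ j vQ '' P.qRegionOf (qPilotObject P.qData) j vQ ∈ (P.frame j vQ).Hul)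
    (hfin : ∀ j : T.Label, (Function.support fun vQ =>
      (S.D P.n).logvol j vQ (Φ₀ j vQ '' P.qRegionOf (qPilotObject P.qData) j vQ)).Finite)
    (hΦ₀ : Φ₀ ∈ Cor312.Setting.indGroup S)
    {n₂ : ℤ} (hq : ∀ (j : T.Label) (vQ : T.VQ), P.qRegion j vQ = A.ρ (S.D n₂) j vQ)
    (j : T.Label) (vQ : T.VQ) :
    (P.qTwistGlue Φ₀ hmem hfin).qRegion j vQ = A.ρ ((S.D n₂).map Φ₀) j vQ := by
  rw [P.qTwistGlue_qRegion Φ₀ hmem hfin j vQ, hq j vQ, ← A.equivariant (S.D n₂) Φ₀ hΦ₀ j vQ]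

/-- **(b2) IS NOT INVARIANT under re-choosing the q-glue alone** (mirror of
`computedBy_twistGlue_iff_fixed`): given (b2) at `P`, the q-twisted setting satisfies the same clause
iff the algorithm's output at `S.D n₂` is fixed by the twist. Note the statement-side asymmetry: the
Corollary is q-twist-invariant only MODULO Step (x)'s volume invariance (row C-7), while the pinning
here is set-level. [folklore] -/
theorem qGlued_qTwistGlue_iff_fixed (A : RegionAlgorithm S) (P : Cor312.Setting S)
    (Φ₀ : S.L.PacketAut)
    (hmem : ∀ (j : T.Label) (vQ : T.VQ),
      Φ₀ j vQ '' P.qRegionOf (qPilotObject P.qData) j vQ ∈ (P.frame j vQ).Hul)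
    (hfin : ∀ j : T.Label, (Function.support fun vQ =>
      (S.D P.n).logvol j vQ (Φ₀ j vQ '' P.qRegionOf (qPilotObject P.qData) j vQ)).Finite)
    (hΦ₀ : Φ₀ ∈ Cor312.Setting.indGroup S)
    {n₂ : ℤ} (hq : ∀ (j : T.Label) (vQ : T.VQ), P.qRegion j vQ = A.ρ (S.D n₂) j vQ) :
    (∀ (j : T.Label) (vQ : T.VQ),
        (P.qTwistGlue Φ₀ hmem hfin).qRegion j vQ = A.ρ (S.D n₂) j vQ) ↔
      ∀ (j : T.Label) (vQ : T.VQ), A.ρ ((S.D n₂).map Φ₀) j vQ = A.ρ (S.D n₂) j vQ := by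
  refine forall_congr' fun j => forall_congr' fun vQ => ?_
  rw [P.qTwistGlue_qRegion Φ₀ hmem hfin j vQ, hq j vQ, ← A.equivariant (S.D n₂) Φ₀ hΦ₀ j vQ]

end Thm311ToCor312

end Summit.ABC.IUTFork
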